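import Summits.BirchSwinnertonDyer.Rank1Residual.Additive.X4RankOneKimTamagawaDefect
import HarnessLib

/-!
# X4 ∧ `r_an = 1`: the RANK-ONE CORNER — from the `∂`-clause, the `≥` half of Kim's Conjecture 1.10
# and ONE Kurihara number the residue at a pair is EXACTLY the LOWER half `Typed.MissingLowerBoundAt`
# (cell `b2b-bsdres`, team n1011, sub-target T-a2r1c — FILE 3a of the T-a2r1 lineage, sequel of
# `Additive/X4RankOneKimTamagawaDefect.lean`; the rank-one twin of p16's N11 corner p250028; the `p = 3`
# census shapes and the composition with p01's LOWER@3 strand are the SIBLING `X4RankOneKimCornerThree.lean`)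

HONEST FRAMING (cell `b2b-bsdres`, run/shared/lean/b2b/bsd-rank1-residual/, verbatim in every
file): the goal of the cell is to DELETE the COMBINATION-SHAPED residual classes of the
Birch–Swinnerton-Dyer formula for ALL analytic-rank `≤ 1` elliptic curves over `ℚ` — "full BSD
formula for every rank `≤ 1` curve in class `C`" assembled STRICTLY from published theorems — so
that the rank-`≤ 1` remainder becomes exactly the CONSTRUCTION-SHAPED classes, which are TYPED
(missing-input `Prop`s), NOT attempted. This is not "finishing BSD". Team n1011: prove what is
provable now; shrink each hard class to its core with data; no claim beyond stated classes;
research routes; census output = EVIDENCE / conjecture items, never a Literature fact; RESIDUAL-MAP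
marks change only by signed lines. X4 stays CONSTRUCTION-SHAPED; §I O7 / N11 stay OPEN; nothing here
is booked. Theorems only (NO definition, NO Literature fact, NO `_holds`); every published input and
every conjecture is an explicit hypothesis; `#print axioms` standard.

COVERAGE (stated first, referee 1 proviso): per pair, `W/ℚ` globally minimal, a prime `p` — ANY `p`,
ANY reduction at `p` — analytic rank `1` (the `p = 3` class shapes on `ClassX4 W 3` ∧ surj(3) ∧ tower
certificate and the (G-ord)@3 / (M)@3 compositions are in the sibling file). The two Kim-at-`p` conjectures (`KimRankOnePartialAt W p` — at `p ≥ 5` DISCHARGED by Kim's Thm. 1.8 (6), the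
Literature fact E73 being filed by harvest-2, one application; at `p = 3` our conjecture / [K25]
announced — and the `≥` half of Conjecture 1.10 `X4.KimTamagawaDefectGeAt W p D.f`) and the
Kurihara-number certificate are HYPOTHESES of every theorem; nothing is asserted about any curve's `Ш`
without them.

## Why (p17's O7 ∩ X4@3 rank-one anatomy of record, two-source R3-22: 10 692 S-b pairs = U 1 575 ·
L2 561 · TAM2+ 7 903 · SHA3 65 · NONSURJ 587 · EXOTIC 1; by half O7-ord 3 585 ((M) 3 009 · Gord3 576)
+ O7-ss 7 107 (t′3 1 759 · w 5 348) — Kim's clause has NO reduction hypothesis, so both halves count)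

FILE 2 (p251411) made the U / L2 / TAM2+ rows (`3 ∤ #Ш_an`) ONE-Kurihara-number-shaped modulo the two
conjectures: a certificate at the exact level `k = ord₃ ∏c + 1` gives `Ш[3^∞] = 0`, hence `BSD(E,3)`.
On the **SHA rows** (`p ∣ #Ш_an`; 65 at `p = 3` = O7-ord 40 + O7-ss 25, all with `ord₃ #Ш_an = 2`;
1 at `p ≥ 5` in cc-eng-1's `class-closure/O7/pairs.tsv`) the same inputs give only the UPPER half: a
certificate at level `k = ord_p ∏c + s + 1` gives `ord_p #Ш ≤ s` (§1), i.e. `Typed.MissingUpperBoundAt W p` as soon as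
`s ≤ ord_p #Ш_an` — and then the missing `p`-part output `Typed.MissingPPartAt W p` is EQUIVALENT to
its LOWER half `Typed.MissingLowerBoundAt W p` (§1: `missingPPartAt_iff_missingLowerBoundAt_…`,
`bsdp_iff_missingLowerBoundAt_…`). This is the rank-one twin of the N11 corner theorem
(`X4RankZero.missingPPartAt_three_iff_lower_of_nonResidue`, p250028: in rank `0` the UPPER half comes
from Kato's (12.5.2)♯ bound; in rank `1` NO Euler-system UPPER bound with exact local terms is in
print at an additive `p` — Kolyvagin's bound carries the Tamagawa fudge, cf. additive-p1's
`ClassX4M.missingUpperBoundAt_rankOne_of_surj_of_lowerTwists_of_odd` which needs `p ∤ ∏c` — so here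
the UPPER half is the `∂`-clause ∘ Conj. 1.10 `≥` ∘ certificate). The LOWER half at `3` is team
n1011's typed T = 0 input in Iwasawa currency: on (G-ord)@3 p01's
`ClassX4Gord.missingLowerBoundAt_three_rankLeOne_of_cycLowerBound` (Delbourgo 2002 (A)+(B) at `3` =
p16's `Delbourgo2002.mainTheorem_three`, Schneider rider, `CycLowerBoundAt W 3 Dh`), on (M)
`ClassX4M.missingLowerBoundAt_rankLeOne_of_cycLowerBound` (`Delbourgo2002.mainTheorem_potMult`) — §3
composes them: `BSD(E,3)` on a SHA3 row of O7-ord ∩ X4 from {`∂`-clause@3, Conj. 1.10 `≥`,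
`CycLowerBoundAt`@3} + ONE certificate at level `ord₃ ∏c + ord₃ #Ш_an + 1` on the 40 O7-ord SHA3 rows.
The 25 O7-ss SHA3 rows (potentially supersingular `3`) have NO lower input in print or typed
(RESIDUAL-MAP O7-ss: nothing formulated) and stay at the iff.

## What this file proves

* §0 BINDER-FREE CORE: `padicValNat_primaryComponent_add_le_of_shaLengthLe_of_tamagawaDefectGe` —
  from the INEQUALITY `(ord_p #Ш(p) : ℕ∞) + ∂^{(∞)}(δ̃) ≤ ∂^{(1)}(δ̃)` (the `≤` content of clause (6)
  in rank one, however obtained: E73 at `p ≥ 5`, [K25] at `p ≥ 3`, our `KimRankOnePartialAt W 3`),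
  `X4.KimTamagawaDefectGeAt W p f` and ONE `δ̃_ℓ ≢ 0 (mod p^k)` at a cyclic `ℓ ∈ 𝒫_k`:
  `ord_p #Ш(p) + ord_p ∏c ≤ k − 1`; and `shaLengthLe_of_kimRankOnePartialAt` (the conjecture-`Prop`
  form gives the inequality).
* §1 PER PAIR, ANY `p`: `padicValNat_shaOrder_le_of_partial_of_tamagawaDefectGe_of_cert` (level
  `ord_p ∏c + s + 1` ⟹ `ord_p #Ш ≤ s`), `missingUpperBoundAt_of_partial_of_tamagawaDefectGe_of_cert`
  (`s ≤ ord_p #Ш_an`), `missingPPartAt_iff_missingLowerBoundAt_of_partial_of_tamagawaDefectGe_of_cert`,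
  `bsdp_iff_missingLowerBoundAt_of_partial_of_tamagawaDefectGe_of_cert` (on a `p ∤ #Ш_an` row the
  LOWER half is automatic — cc-typer-2's `N10.missingLowerBoundAt_of_padicValRat_le_zero` — so FILE 2's
  `bsdp_of_partial_…_of_shaAn_unit` is the `s = 0` instance), and the LEVEL-SIDE PREDICTION on SHA rows
  `kuriharaNumber_eq_zero_of_partial_of_tamagawaDefectGe_of_lower_of_level_le`: if the LOWER half
  holds at the pair (e.g. under BSD) NO non-zero `δ̃_ℓ^{(k)}` exists at a cyclic prime of level
  `k ≤ ord_p ∏c + ord_p #Ш_an` — the first informative certificate sits at `ord_p ∏c + ord_p #Ш_an + 1`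
  exactly (EVIDENCE target for the I-12@3 rank-one request; an earlier non-zero value refutes
  {(6)-`≤`, Conj. 1.10 `≥`, LOWER} at that pair — anomaly protocol).
* §2–§3 (SIBLING `X4RankOneKimCornerThree.lean`): the `p = 3` census shapes on O7 ∩ X4@3 and the
  compositions with p01's LOWER@3 on (G-ord)@3 / (M)@3.

Dead ends recorded (not silently dropped): (a) a certificate-only LOWER bound in rank one does not
exist — `∂^{(1)} ≥ j` is a statement about ALL prime-level Kurihara numbers (Kim §1.5.1), so the SHA
rows are not one-certificate-shaped on the lower side by this route; (b) Cassels–Tate parity does not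
help on SHA rows (it sharpens `≤ s` to `≤ s − 1` only for odd `s`, and `ord_p #Ш_an` is even in rank
`≤ 1` under BSD); (c) the EXOTIC row (no tower certificate) and the NONSURJ rows (O8) are outside
every theorem here, as in FILES 1–2.

References: C.-H. Kim, Amer. J. Math. 148 (2026) 79–129 = arXiv:2203.12159v4 [Kim2022StructureSelmer]
Thm. 1.9 (6), §1.5.1, Conj. 1.10 (PDF p. 8); C.-H. Kim (app. R. Pollack), arXiv:2505.09121v1
[Kim2025RefinedTNC] Thm. 1.1 (PREPRINT, the reason at `p = 3`, not a source of truth); D. Delbourgo,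
J. Number Theory 95 (2002) [Delbourgo2002] Thm. (A), (B) (p. 40), Hypothesis (p. 39); R. L. Miller,
LMS J. Comput. Math. 14 (2011) [Miller2011LMS] Def. 1.1; J.-P. Serre, *Abelian ℓ-adic representations*
[SerreAbelianLadic1968] IV-23; J. E. Cremona, *Algorithms* [CremonaAlgorithms1997] §2.8; cell files
cells/n1011/OWNERS.md (T-a2r1c, T-O7, T-N10C), cells/n1011/PLAN.md R3-15 / R4-6, HOME/INBOX.md
2026-08-21 06:30Z (harvest-2 E73) / 06:33Z (p17).
-/

noncomputable section

open scoped Classical MatrixGroups ModularForm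

open CongruenceSubgroup WeierstrassCurve Literature.NumberTheory.EllipticCurves
  Literature.NumberTheory.EllipticCurves.ModularForms
  Literature.NumberTheory.EllipticCurves.Rank1Residual
  Literature.NumberTheory.EllipticCurves.Rank1Residual.Typed

namespace Summit.BirchSwinnertonDyer.Rank1Residual.Additive

/-! ## §0 The binder-free core: the `≤` content of clause (6) + Conj. 1.10 `≥` + ONE certificate -/

section Core

variable (W : WeierstrassCurve ℚ) [W.IsGloballyMinimal] (p : ℕ) {N : ℕ} (f : CuspForm (Gamma0 N) 2)

/-- **CORE (binder-free): `ord_p #Ш(E/ℚ)(p) + ord_p ∏_ℓ c_ℓ ≤ k − 1`** from (i) the `≤` content of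
Kim's clause (6) in analytic rank `1`, `(ord_p #Ш(p) : ℕ∞) + ∂^{(∞)}(δ̃) ≤ ∂^{(1)}(δ̃)` (`hLe`, however
obtained), (ii) the `≥` half of Conjecture 1.10 `ord_p ∏c ≤ ∂^{(∞)}` (`hGe`) and (iii) ONE Kurihara
number `δ̃_ℓ ≢ 0 (mod p^k)` at a cyclic Kolyvagin prime `ℓ ∈ 𝒫_k`, `k ≥ 1` (which gives
`∂^{(1)} ≤ k − 1`, FILE 1 §0). No surjectivity / tower / `L`-value / rank binder enters THIS step.
[cite: Kim2022StructureSelmer, Thm. 1.9 (6), §1.5.1 and Conj. 1.10 (PDF pp. 7–8)] -/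
theorem padicValNat_primaryComponent_add_le_of_shaLengthLe_of_tamagawaDefectGe
    (hLe : (padicValNat p (Nat.card (AddCommGroup.primaryComponent W.sha p)) : ℕ∞) +
        kuriharaPartialInfty W p f ≤ kuriharaPartial W p f 1)
    (hGe : X4.KimTamagawaDefectGeAt W p f)
    {k : ℕ} (hk : 1 ≤ k) (ℓ : ℕ) [Fact ℓ.Prime] (hℓ : Kato.IsKolyvaginPrime W p k ℓ)
    (hcyc : Nat.card {P : ((WeierstrassCurve.integralModelInt W).map
        (Int.castRingHom (ZMod ℓ))).toAffine.Point // p • P = 0} ≤ p)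
    (ψ : (ℓ' : ℕ) → (ZMod ℓ')ˣ →* Multiplicative (ZMod (p ^ k)))
    (hψ : Function.Surjective (ψ ℓ)) (hδ : kuriharaNumber f (p ^ k) ℓ ψ ≠ 0) :
    padicValNat p (Nat.card (AddCommGroup.primaryComponent W.sha p)) +
      padicValNat p W.tamagawaProduct ≤ k - 1 := by
  have h1 : kuriharaPartial W p f 1 ≤ ((k - 1 : ℕ) : ℕ∞) :=
    kuriharaPartial_one_le_of_kuriharaNumber_ne_zero W p f hk hℓ hcyc ψ hψ hδ
  have h2 : (padicValNat p (Nat.card (AddCommGroup.primaryComponent W.sha p)) : ℕ∞) +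
      (padicValNat p W.tamagawaProduct : ℕ∞) ≤ ((k - 1 : ℕ) : ℕ∞) :=
    calc (padicValNat p (Nat.card (AddCommGroup.primaryComponent W.sha p)) : ℕ∞) +
          (padicValNat p W.tamagawaProduct : ℕ∞)
        ≤ (padicValNat p (Nat.card (AddCommGroup.primaryComponent W.sha p)) : ℕ∞) +
            kuriharaPartialInfty W p f := add_le_add le_rfl hGe
      _ ≤ kuriharaPartial W p f 1 := hLe
      _ ≤ ((k - 1 : ℕ) : ℕ∞) := h1
  exact_mod_cast h2

/-- **CORE, level `ord_p ∏c + s + 1`: `ord_p #Ш(E/ℚ)(p) ≤ s`.** [cite: Kim2022StructureSelmer, Thm. 1.9 (6), §1.5.1 and Conj. 1.10 (PDF pp. 7–8)] -/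
theorem padicValNat_primaryComponent_le_of_shaLengthLe_of_tamagawaDefectGe
    (hLe : (padicValNat p (Nat.card (AddCommGroup.primaryComponent W.sha p)) : ℕ∞) +
        kuriharaPartialInfty W p f ≤ kuriharaPartial W p f 1)
    (hGe : X4.KimTamagawaDefectGeAt W p f) (s : ℕ)
    (ℓ : ℕ) [Fact ℓ.Prime] (hℓ : Kato.IsKolyvaginPrime W p (padicValNat p W.tamagawaProduct + s + 1) ℓ)
    (hcyc : Nat.card {P : ((WeierstrassCurve.integralModelInt W).map
        (Int.castRingHom (ZMod ℓ))).toAffine.Point // p • P = 0} ≤ p)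
    (ψ : (ℓ' : ℕ) → (ZMod ℓ')ˣ →* Multiplicative (ZMod (p ^ (padicValNat p W.tamagawaProduct + s + 1))))
    (hψ : Function.Surjective (ψ ℓ))
    (hδ : kuriharaNumber f (p ^ (padicValNat p W.tamagawaProduct + s + 1)) ℓ ψ ≠ 0) :
    padicValNat p (Nat.card (AddCommGroup.primaryComponent W.sha p)) ≤ s := by
  have h := padicValNat_primaryComponent_add_le_of_shaLengthLe_of_tamagawaDefectGe W p f hLe hGe
    (by omega) ℓ hℓ hcyc ψ hψ hδ
  omega

end Core

/-! ## §1 Per pair, any `p`: the `∂`-clause `Prop`, the UPPER half, and the corner `iff` -/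

section PerPair

variable (W : WeierstrassCurve ℚ) [W.IsElliptic] [W.IsGloballyMinimal] (p : ℕ) [Fact p.Prime]

/-- The conjecture-`Prop` `KimRankOnePartialAt W p` (an EQUALITY behind the T-a2 binder block) gives the
`≤` content used by the core, once a certificate makes `∂^{(1)} ≠ ∞`. At `p ≥ 5` `hK` is Kim's
THEOREM (E73, harvest-2) — one application; at `p = 3` it is our conjecture (`X4SharpThreeKimRankOnePartial`).
[cite: Kim2022StructureSelmer, Thm. 1.9 (6) (PDF p. 8)] -/
theorem shaLengthLe_of_kimRankOnePartialAt (hK : KimRankOnePartialAt W p)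
    (hsurj : W.HasSurjectiveModNGaloisRep p)
    (htower : ∀ n : ℕ, W.HasSurjectiveModNGaloisRep (p ^ n : ℕ)) (hL : W.entireLFunction 1 = 0)
    (hr : W.analyticRank = 1) (hfin : Finite W.sha)
    {N : ℕ} [NeZero N] (D : ModularParametrizationData W N) (hc : ¬ (p : ℤ) ∣ D.maninConstant)
    (hper : ∃ u : ℚ, ‖(u : ℚ_[p])‖ = 1 ∧ W.realPeriodRat = u * plusPeriod D.f)
    (hne : kuriharaPartial W p D.f 1 ≠ ⊤) :
    (padicValNat p (Nat.card (AddCommGroup.primaryComponent W.sha p)) : ℕ∞) +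
      kuriharaPartialInfty W p D.f ≤ kuriharaPartial W p D.f 1 :=
  le_of_eq (hK hsurj htower hL hr hfin D hc hper hne)

/-- **Level `ord_p ∏c + s + 1` ⟹ `ord_p #Ш(E/ℚ) ≤ s`** (per pair, ANY reduction at `p`), granted the
`∂`-clause `KimRankOnePartialAt W p` and the `≥` half of Conjecture 1.10, from ONE Kurihara number
`δ̃_ℓ ≢ 0 (mod p^{ord_p ∏c + s + 1})` at a cyclic `ℓ ∈ 𝒫_{ord_p ∏c + s + 1}`; `Ш` finite (`hfin`) so
`ord_p #Ш = ord_p #Ш(p)`. [cite: Kim2022StructureSelmer, Thm. 1.9 (6), Conj. 1.10 (PDF p. 8)] -/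
theorem padicValNat_shaOrder_le_of_partial_of_tamagawaDefectGe_of_cert (hK : KimRankOnePartialAt W p)
    (hsurj : W.HasSurjectiveModNGaloisRep p)
    (htower : ∀ n : ℕ, W.HasSurjectiveModNGaloisRep (p ^ n : ℕ)) (hL : W.entireLFunction 1 = 0)
    (hr : W.analyticRank = 1) (hfin : Finite W.sha)
    {N : ℕ} [NeZero N] (D : ModularParametrizationData W N) (hc : ¬ (p : ℤ) ∣ D.maninConstant)
    (hper : ∃ u : ℚ, ‖(u : ℚ_[p])‖ = 1 ∧ W.realPeriodRat = u * plusPeriod D.f)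
    (hGe : X4.KimTamagawaDefectGeAt W p D.f) (s : ℕ)
    (ℓ : ℕ) [Fact ℓ.Prime] (hℓ : Kato.IsKolyvaginPrime W p (padicValNat p W.tamagawaProduct + s + 1) ℓ)
    (hcyc : Nat.card {P : ((WeierstrassCurve.integralModelInt W).map
        (Int.castRingHom (ZMod ℓ))).toAffine.Point // p • P = 0} ≤ p)
    (ψ : (ℓ' : ℕ) → (ZMod ℓ')ˣ →* Multiplicative (ZMod (p ^ (padicValNat p W.tamagawaProduct + s + 1))))
    (hψ : Function.Surjective (ψ ℓ))
    (hδ : kuriharaNumber D.f (p ^ (padicValNat p W.tamagawaProduct + s + 1)) ℓ ψ ≠ 0) :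
    padicValNat p W.shaOrder ≤ s := by
  haveI : Finite W.sha := hfin
  have hne : kuriharaPartial W p D.f 1 ≠ ⊤ :=
    ne_top_of_le_ne_top (ENat.coe_ne_top _)
      (kuriharaPartial_one_le_of_kuriharaNumber_ne_zero W p D.f (by omega) hℓ hcyc ψ hψ hδ)
  have h := padicValNat_primaryComponent_le_of_shaLengthLe_of_tamagawaDefectGe W p D.f
    (shaLengthLe_of_kimRankOnePartialAt W p hK hsurj htower hL hr hfin D hc hper hne) hGe s ℓ hℓ hcyc
    ψ hψ hδ
  rw [padicValNat_card_addPrimaryComponent p] at h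
  unfold WeierstrassCurve.shaOrder
  exact h

/-- **The UPPER half `Typed.MissingUpperBoundAt W p` from ONE certificate at level
`ord_p ∏c + s + 1` with `s ≤ ord_p #Ш_an`** (per pair, any reduction, both conjectures explicit).
[cite: Kim2022StructureSelmer, Thm. 1.9 (6), Conj. 1.10 (PDF p. 8)] [cite: Miller2011LMS, Def. 1.1] -/
theorem missingUpperBoundAt_of_partial_of_tamagawaDefectGe_of_cert (hK : KimRankOnePartialAt W p)
    (hsurj : W.HasSurjectiveModNGaloisRep p)
    (htower : ∀ n : ℕ, W.HasSurjectiveModNGaloisRep (p ^ n : ℕ)) (hL : W.entireLFunction 1 = 0)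
    (hr : W.analyticRank = 1) (hfin : Finite W.sha)
    {N : ℕ} [NeZero N] (D : ModularParametrizationData W N) (hc : ¬ (p : ℤ) ∣ D.maninConstant)
    (hper : ∃ u : ℚ, ‖(u : ℚ_[p])‖ = 1 ∧ W.realPeriodRat = u * plusPeriod D.f)
    (hGe : X4.KimTamagawaDefectGeAt W p D.f) {q : ℚ} (hq : shaAn W = (q : ℂ)) (s : ℕ)
    (hs : (s : ℤ) ≤ padicValRat p q)
    (ℓ : ℕ) [Fact ℓ.Prime] (hℓ : Kato.IsKolyvaginPrime W p (padicValNat p W.tamagawaProduct + s + 1) ℓ)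
    (hcyc : Nat.card {P : ((WeierstrassCurve.integralModelInt W).map
        (Int.castRingHom (ZMod ℓ))).toAffine.Point // p • P = 0} ≤ p)
    (ψ : (ℓ' : ℕ) → (ZMod ℓ')ˣ →* Multiplicative (ZMod (p ^ (padicValNat p W.tamagawaProduct + s + 1))))
    (hψ : Function.Surjective (ψ ℓ))
    (hδ : kuriharaNumber D.f (p ^ (padicValNat p W.tamagawaProduct + s + 1)) ℓ ψ ≠ 0) :
    MissingUpperBoundAt W p := by
  have h := padicValNat_shaOrder_le_of_partial_of_tamagawaDefectGe_of_cert W p hK hsurj htower hL hr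
    hfin D hc hper hGe s ℓ hℓ hcyc ψ hψ hδ
  refine ⟨q, hq, le_trans ?_ hs⟩
  exact_mod_cast h

/-- **THE RANK-ONE CORNER at the pair**: under the hypotheses of
`missingUpperBoundAt_of_partial_of_tamagawaDefectGe_of_cert` (the `∂`-clause, Conj. 1.10 `≥`, ONE
certificate at level `ord_p ∏c + s + 1`, `s ≤ ord_p #Ш_an`), the missing `p`-part output IS its LOWER
half: `Typed.MissingPPartAt W p ↔ Typed.MissingLowerBoundAt W p`. Per pair; nothing booked.
[cite: Kim2022StructureSelmer, Thm. 1.9 (6), Conj. 1.10 (PDF p. 8)] [cite: Miller2011LMS, Def. 1.1] -/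
theorem missingPPartAt_iff_missingLowerBoundAt_of_partial_of_tamagawaDefectGe_of_cert
    (hK : KimRankOnePartialAt W p) (hsurj : W.HasSurjectiveModNGaloisRep p)
    (htower : ∀ n : ℕ, W.HasSurjectiveModNGaloisRep (p ^ n : ℕ)) (hL : W.entireLFunction 1 = 0)
    (hr : W.analyticRank = 1) (hfin : Finite W.sha)
    {N : ℕ} [NeZero N] (D : ModularParametrizationData W N) (hc : ¬ (p : ℤ) ∣ D.maninConstant)
    (hper : ∃ u : ℚ, ‖(u : ℚ_[p])‖ = 1 ∧ W.realPeriodRat = u * plusPeriod D.f)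
    (hGe : X4.KimTamagawaDefectGeAt W p D.f) {q : ℚ} (hq : shaAn W = (q : ℂ)) (s : ℕ)
    (hs : (s : ℤ) ≤ padicValRat p q)
    (ℓ : ℕ) [Fact ℓ.Prime] (hℓ : Kato.IsKolyvaginPrime W p (padicValNat p W.tamagawaProduct + s + 1) ℓ)
    (hcyc : Nat.card {P : ((WeierstrassCurve.integralModelInt W).map
        (Int.castRingHom (ZMod ℓ))).toAffine.Point // p • P = 0} ≤ p)
    (ψ : (ℓ' : ℕ) → (ZMod ℓ')ˣ →* Multiplicative (ZMod (p ^ (padicValNat p W.tamagawaProduct + s + 1))))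
    (hψ : Function.Surjective (ψ ℓ))
    (hδ : kuriharaNumber D.f (p ^ (padicValNat p W.tamagawaProduct + s + 1)) ℓ ψ ≠ 0) :
    MissingPPartAt W p ↔ MissingLowerBoundAt W p :=
  ⟨fun h => (lower_and_upper_of_missingPPartAt W p h).1, fun hl =>
    missingPPartAt_of_lower_of_upper W p hl
      (missingUpperBoundAt_of_partial_of_tamagawaDefectGe_of_cert W p hK hsurj htower hL hr hfin D hc
        hper hGe hq s hs ℓ hℓ hcyc ψ hψ hδ)⟩

/-- **`BSD(E,p) ↔ Typed.MissingLowerBoundAt W p`** under the same hypotheses, with Gross–Zagier–Kolyvagin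
(`hGZK`: `rank = r_an`, `Ш` finite) and modularity (`hmod`: `L(E,1) = 0` from `r_an = 1`). Per pair;
ANY reduction at `p`; nothing booked. [cite: Kim2022StructureSelmer, Thm. 1.9 (6), Conj. 1.10 (PDF p. 8)]
[cite: Miller2011LMS, §1 and Def. 1.1] -/
theorem bsdp_iff_missingLowerBoundAt_of_partial_of_tamagawaDefectGe_of_cert
    (hK : KimRankOnePartialAt W p) (hGZK : rank_eq_analyticRank_of_analyticRank_le_one)
    (hmod : hasEntireLFunction_rat) (hsurj : W.HasSurjectiveModNGaloisRep p)
    (htower : ∀ n : ℕ, W.HasSurjectiveModNGaloisRep (p ^ n : ℕ)) (hr : W.analyticRank = 1)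
    {N : ℕ} [NeZero N] (D : ModularParametrizationData W N) (hc : ¬ (p : ℤ) ∣ D.maninConstant)
    (hper : ∃ u : ℚ, ‖(u : ℚ_[p])‖ = 1 ∧ W.realPeriodRat = u * plusPeriod D.f)
    (hGe : X4.KimTamagawaDefectGeAt W p D.f) {q : ℚ} (hq : shaAn W = (q : ℂ)) (s : ℕ)
    (hs : (s : ℤ) ≤ padicValRat p q)
    (ℓ : ℕ) [Fact ℓ.Prime] (hℓ : Kato.IsKolyvaginPrime W p (padicValNat p W.tamagawaProduct + s + 1) ℓ)
    (hcyc : Nat.card {P : ((WeierstrassCurve.integralModelInt W).map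
        (Int.castRingHom (ZMod ℓ))).toAffine.Point // p • P = 0} ≤ p)
    (ψ : (ℓ' : ℕ) → (ZMod ℓ')ˣ →* Multiplicative (ZMod (p ^ (padicValNat p W.tamagawaProduct + s + 1))))
    (hψ : Function.Surjective (ψ ℓ))
    (hδ : kuriharaNumber D.f (p ^ (padicValNat p W.tamagawaProduct + s + 1)) ℓ ψ ≠ 0) :
    BSDp W p ↔ MissingLowerBoundAt W p := by
  have hr1 : W.analyticRank ≤ 1 := by rw [hr]
  have hL : W.entireLFunction 1 = 0 := by
    by_contra hne
    have h0 := (W.analyticRank_eq_zero_iff_holds (hmod W)).mpr hne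
    omega
  have hfin : Finite W.sha := (hGZK W hr1).2
  haveI : Finite W.sha := hfin
  have hiff := missingPPartAt_iff_missingLowerBoundAt_of_partial_of_tamagawaDefectGe_of_cert W p hK
    hsurj htower hL hr hfin D hc hper hGe hq s hs ℓ hℓ hcyc ψ hψ hδ
  constructor
  · intro h
    exact hiff.mp (missingPPartAt_of_bsdp W p h)
  · intro hl
    exact bsdp_of_missingPPartAt W p hGZK hr1 (hiff.mpr hl)

/-- **LEVEL-SIDE PREDICTION on SHA rows.** If the LOWER half holds at the pair (`ord_p #Ш_an ≤ ord_p #Ш`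
— e.g. under BSD, or from `CycLowerBoundAt` at `3`), then — granted the `∂`-clause and Conj. 1.10 `≥` —
NO Kurihara number is non-zero modulo `p^k` at a cyclic Kolyvagin prime of level
`k ≤ ord_p ∏c + ord_p #Ш_an`: the first informative certificate lives at level
`ord_p ∏c + ord_p #Ш_an + 1` exactly. Rank one; per pair; a non-zero value below that level is an
ANOMALY refuting the conjunction at the pair. [cite: Kim2022StructureSelmer, §1.5.1 and Conj. 1.10 (PDF pp. 7–8)]
[cite: Miller2011LMS, Def. 1.1] -/
theorem kuriharaNumber_eq_zero_of_partial_of_tamagawaDefectGe_of_lower_of_level_le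
    (hK : KimRankOnePartialAt W p) (hsurj : W.HasSurjectiveModNGaloisRep p)
    (htower : ∀ n : ℕ, W.HasSurjectiveModNGaloisRep (p ^ n : ℕ)) (hL : W.entireLFunction 1 = 0)
    (hr : W.analyticRank = 1) (hfin : Finite W.sha)
    {N : ℕ} [NeZero N] (D : ModularParametrizationData W N) (hc : ¬ (p : ℤ) ∣ D.maninConstant)
    (hper : ∃ u : ℚ, ‖(u : ℚ_[p])‖ = 1 ∧ W.realPeriodRat = u * plusPeriod D.f)
    (hGe : X4.KimTamagawaDefectGeAt W p D.f) {q : ℚ} (hq : shaAn W = (q : ℂ))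
    (hlow : MissingLowerBoundAt W p)
    {k : ℕ} (hk : 1 ≤ k) (hkle : (k : ℤ) ≤ padicValNat p W.tamagawaProduct + padicValRat p q)
    (ℓ : ℕ) [Fact ℓ.Prime] (hℓ : Kato.IsKolyvaginPrime W p k ℓ)
    (hcyc : Nat.card {P : ((WeierstrassCurve.integralModelInt W).map
        (Int.castRingHom (ZMod ℓ))).toAffine.Point // p • P = 0} ≤ p)
    (ψ : (ℓ' : ℕ) → (ZMod ℓ')ˣ →* Multiplicative (ZMod (p ^ k)))
    (hψ : Function.Surjective (ψ ℓ)) : kuriharaNumber D.f (p ^ k) ℓ ψ = 0 := by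
  by_contra hδ
  haveI : Finite W.sha := hfin
  obtain ⟨q', hq', hle⟩ := hlow
  have hqq : q' = q := by exact_mod_cast hq'.symm.trans hq
  subst hqq
  have hne : kuriharaPartial W p D.f 1 ≠ ⊤ :=
    ne_top_of_le_ne_top (ENat.coe_ne_top _)
      (kuriharaPartial_one_le_of_kuriharaNumber_ne_zero W p D.f hk hℓ hcyc ψ hψ hδ)
  have h := padicValNat_primaryComponent_add_le_of_shaLengthLe_of_tamagawaDefectGe W p D.f
    (shaLengthLe_of_kimRankOnePartialAt W p hK hsurj htower hL hr hfin D hc hper hne) hGe hk ℓ hℓ hcyc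
    ψ hψ hδ
  rw [padicValNat_card_addPrimaryComponent p] at h
  have h' : (padicValNat p (Nat.card W.sha) : ℤ) + padicValNat p W.tamagawaProduct ≤ (k : ℤ) - 1 := by
    have := h; omega
  have hle' : padicValRat p q' ≤ (padicValNat p (Nat.card W.sha) : ℤ) := by
    unfold WeierstrassCurve.shaOrder at hle; exact hle
  omega

end PerPair

end Summit.BirchSwinnertonDyer.Rank1Residual.Additive

end
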